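import Mathlib
import Summits.MatrixMultiplication.MatrixMultiplication.Theorems.SnSubsetDichotomyPolynomialSlackLevelOnePinning
import Summits.MatrixMultiplication.MatrixMultiplication.Theorems.SnSubsetDichotomyPolynomialSlackMarginals
import Summits.MatrixMultiplication.MatrixMultiplication.Theorems.SnSubsetDichotomyPolynomialSlackPositivity
import Summits.MatrixMultiplication.MatrixMultiplication.Theorems.SnSubsetDichotomyPolynomialSlackDeficitBudgetU

/-!
# Lopsided near the wall: TPP triples of `S_n` in the first window have a dense quotient set

The LEVEL-ONE programme on the crux `SnSubsetDichotomy.PolynomialSlack` (stmt-MatrixMultiplication-8306;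
idea card `deficit-budget-positivity`, `LopsidedNearWall`), assembled. For a parity-pure TPP triple
`S, T, U ⊆ S_n` (`n ≥ 40`) with `N = |S||T||U|` and quotient sizes `α = |S||T|`, `β = |T||U|`, `γ = |U||S|`:

  `2N ≤ n! + n!·√(n!)/√D + (20·n!/√n)·(√(α·L_α) + √(β·L_β) + √(γ·L_γ))`,  `D = n(n-1)/6`,
  `L_x = (1 + log n)·log(4n·n!/x)`,

UNCONDITIONAL (the Bernstein inequality for randomly permuted sums is the tree's own
`card_permutedSum_tail_le`; with the sharper named fact `Literature.Probability.Moments.BercuDelyonRio2015_permutedSum`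
the factor `1 + log n` in `L_x` disappears). Ingredients, all tree theorems of this programme:
the pinning `levelOnePinning` (`2(n-1)(N² - T₃) ≥ 2N² - n!N - N·n!^{3/2}/√D`), the counting identity
`sixFoldFix_eq_tripleSum` (`T₃ = Σ m_{ST} m_{TU} m_{US}`), the centring identities and the positivity
inequality of `…Positivity` (`-Σ PQR ≤ Σ_cyc ‖P‖‖Q‖‖R⁻‖` for the centred normalised marginals), the
excess cap `excess_cap_pair` (`‖P‖² ≤ n!/((n-1)α)`) and the deficit budget `deficit_budget`
(`‖P⁻‖² ≤ 100(1+log n)·L_α/n`, via `pairMarginal_eq_marginal_image₂`; unconditional form `deficit_budget'`). At the quasirandom wall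
`N ≈ (n!)^{3/2}/√n` this forces a quotient set of density `≳ 1/log n`; for BALANCED triples it gives
`|S|³ ≤ K(n!)^{3/2}(log n/n)^{3/4}` (next file), i.e. the crux for balanced triples for every `C < 3/4`.
-/

namespace Summit.MatrixMultiplication.MatrixMultiplication.Theorems.PolynomialSlack

open scoped BigOperators
open Literature.Combinatorics.Additive (TripleProductProperty)

-- `Summit.<Summit>.<Problem>` is the tree's mandated summit-side namespace (CONVENTIONS §2); for
-- this single-conjunct summit the two coincide, so each declaration silences `dupNamespace`.
set_option linter.dupNamespace false

/-- Centred normalised pair marginals: the norm bound from the excess cap, `Σ(m/α - 1/n)² ≤ n!/((n-1)α)`.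
[folklore] -/
theorem sumSq_centered_pair_le {n : ℕ} (hn : 40 ≤ n) {X Y : Finset (Equiv.Perm (Fin n))}
    (hX : X.Nonempty) (hY : Y.Nonempty)
    (hinj : Set.InjOn (fun xy : Equiv.Perm (Fin n) × Equiv.Perm (Fin n) => xy.1⁻¹ * xy.2)
      (↑X ×ˢ ↑Y : Set (Equiv.Perm (Fin n) × Equiv.Perm (Fin n)))) :
    ∑ i : Fin n, ∑ j : Fin n,
        ((((X ×ˢ Y).filter fun xy => xy.2 j = xy.1 i).card : ℝ) / (X.card * Y.card : ℕ) - 1 / n) ^ 2 ≤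
      (n.factorial : ℝ) / (((n : ℝ) - 1) * (X.card * Y.card : ℕ)) := by
  have hn0 : n ≠ 0 := by omega
  have hn1 : (0 : ℝ) < (n : ℝ) - 1 := by
    have : (40 : ℝ) ≤ n := by exact_mod_cast hn
    linarith
  have hα0 : (0 : ℝ) < (X.card * Y.card : ℕ) := by
    exact_mod_cast Nat.mul_pos hX.card_pos hY.card_pos
  set α : ℝ := ((X.card * Y.card : ℕ) : ℝ) with hα
  set m : Fin n → Fin n → ℝ := fun i j => (((X ×ˢ Y).filter fun xy => xy.2 j = xy.1 i).card : ℝ) with hm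
  have hrow : ∀ i, ∑ j : Fin n, m i j / α = 1 := fun i => by
    rw [← Finset.sum_div, div_eq_one_iff_eq hα0.ne']
    have h2 : ∑ j : Fin n, ((((X ×ˢ Y).filter fun xy => xy.2 j = xy.1 i).card : ℕ) : ℝ) =
        ((X.card * Y.card : ℕ) : ℝ) := by exact_mod_cast sum_pairMarginal_snd X Y i
    exact h2
  have hcentre := sumSq_centered_eq hn0 (fun i j => m i j / α) hrow
  have hcap := excess_cap_pair hn hinj
  rw [← hα] at hcap
  have hsq : ∑ i : Fin n, ∑ j : Fin n, (m i j / α) ^ 2 = (∑ i : Fin n, ∑ j : Fin n, m i j ^ 2) / α ^ 2 := by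
    rw [Finset.sum_div]
    refine Finset.sum_congr rfl fun i _ => ?_
    rw [Finset.sum_div]
    refine Finset.sum_congr rfl fun j _ => ?_
    rw [div_pow]
  change ∑ i : Fin n, ∑ j : Fin n, (m i j / α - 1 / n) ^ 2 ≤ (n.factorial : ℝ) / (((n : ℝ) - 1) * α)
  rw [hcentre, hsq, div_sub_one (pow_ne_zero 2 hα0.ne'), div_le_div_iff₀ (pow_pos hα0 2) (mul_pos hn1 hα0)]
  -- `(Σ m² - α²)(n-1)α ≤ n! α²` from `(n-1) Σ m² ≤ α(n! + (n-2)α)`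
  have hcap' : ((n : ℝ) - 1) * ∑ i : Fin n, ∑ j : Fin n, m i j ^ 2 ≤ α * ((n.factorial : ℝ) + ((n : ℝ) - 2) * α) := hcap
  nlinarith [hcap', hα0]

/-- Centred normalised pair marginals: the deficit bound,
`Σ max(0, 1/n - m/α)² ≤ 100·(1 + log n)·log(4n·n!/α)/n` (from `deficit_budget'`). [folklore] -/
theorem sumSq_deficit_pair_le {n : ℕ} (hn : 40 ≤ n) {X Y : Finset (Equiv.Perm (Fin n))} (hX : X.Nonempty) (hY : Y.Nonempty)
    (hinj : Set.InjOn (fun xy : Equiv.Perm (Fin n) × Equiv.Perm (Fin n) => xy.1⁻¹ * xy.2)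
      (↑X ×ˢ ↑Y : Set (Equiv.Perm (Fin n) × Equiv.Perm (Fin n)))) :
    ∑ i : Fin n, ∑ j : Fin n,
        (max 0 (-((((X ×ˢ Y).filter fun xy => xy.2 j = xy.1 i).card : ℝ) / (X.card * Y.card : ℕ) - 1 / n))) ^ 2 ≤
      100 * ((1 + Real.log n) * Real.log (4 * n * n.factorial / (X.card * Y.card : ℕ))) / n := by
  classical
  have hn1 : 1 ≤ n := by omega
  have hn0 : (0 : ℝ) < n := by exact_mod_cast (show 0 < n by omega)
  have hα0 : (0 : ℝ) < (X.card * Y.card : ℕ) := by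
    exact_mod_cast Nat.mul_pos hX.card_pos hY.card_pos
  have hAcard : (Finset.image₂ (fun x y : Equiv.Perm (Fin n) => x⁻¹ * y) X Y).card = X.card * Y.card :=
    card_image₂_of_injOn' hinj
  have hAne : (Finset.image₂ (fun x y : Equiv.Perm (Fin n) => x⁻¹ * y) X Y).Nonempty :=
    Finset.card_pos.1 (by rw [hAcard]; exact Nat.mul_pos hX.card_pos hY.card_pos)
  have hbud := deficit_budget' hn1 _ hAne
  rw [hAcard] at hbud
  simp_rw [← pairMarginal_eq_marginal_image₂ hinj] at hbud
  set α : ℝ := ((X.card * Y.card : ℕ) : ℝ) with hα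
  -- `max(0, 1/n - m/α) = max(0, α/n - m)/α`
  have hpt : ∀ i j : Fin n,
      (max 0 (-((((X ×ˢ Y).filter fun xy => xy.2 j = xy.1 i).card : ℝ) / α - 1 / n))) ^ 2 =
        (max 0 (α / n - (((X ×ˢ Y).filter fun xy => xy.2 j = xy.1 i).card : ℝ))) ^ 2 / α ^ 2 := by
    intro i j
    have e : -((((X ×ˢ Y).filter fun xy => xy.2 j = xy.1 i).card : ℝ) / α - 1 / n) =
        (α / n - (((X ×ˢ Y).filter fun xy => xy.2 j = xy.1 i).card : ℝ)) * α⁻¹ := by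
      field_simp; ring
    have e' : -((((X ×ˢ Y).filter fun xy => xy.2 j = xy.1 i).card : ℝ) / α - 1 / n) =
        (α / n - (((X ×ˢ Y).filter fun xy => xy.2 j = xy.1 i).card : ℝ)) / α := by
      rw [e]; ring
    have key : ∀ y : ℝ, max 0 (y / α) = max 0 y / α := by
      intro y
      rcases le_total 0 y with h | h
      · rw [max_eq_right h, max_eq_right (div_nonneg h hα0.le)]
      · have : y / α ≤ 0 := by rw [div_le_iff₀ hα0, zero_mul]; exact h
        rw [max_eq_left h, max_eq_left this, zero_div]
    rw [e', key, div_pow]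
  simp_rw [hpt, ← Finset.sum_div]
  rw [div_le_iff₀ (pow_pos hα0 2)]
  calc ∑ i : Fin n, ∑ j : Fin n,
        (max 0 (α / n - (((X ×ˢ Y).filter fun xy => xy.2 j = xy.1 i).card : ℝ))) ^ 2
      ≤ 100 * (1 + Real.log n) * (α ^ 2 / n) * Real.log (4 * n * n.factorial / α) := hbud
    _ = 100 * ((1 + Real.log n) * Real.log (4 * n * n.factorial / α)) / n * α ^ 2 := by ring

/-- The per-term algebra: `2m·N²·√(F/(mα))·√(F/(mβ))·√(100L/ν) = (20F/√ν)·N·√(γL)` when `αβγ = N²`.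
[folklore] -/
theorem cyclicTerm_eq {α β γ N F L m ν : ℝ} (hα : 0 < α) (hβ : 0 < β) (hγ : 0 < γ) (hN : 0 < N)
    (hNsq : α * β * γ = N ^ 2) (hm : 0 < m) (hν : 0 < ν) (hF : 0 ≤ F) (hL : 0 ≤ L) :
    2 * m * N ^ 2 * (Real.sqrt (F / (m * α)) * Real.sqrt (F / (m * β)) * Real.sqrt (100 * L / ν)) =
      20 * F / Real.sqrt ν * N * Real.sqrt (γ * L) := by
  have hl : 0 ≤ 2 * m * N ^ 2 * (Real.sqrt (F / (m * α)) * Real.sqrt (F / (m * β)) * Real.sqrt (100 * L / ν)) := by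
    positivity
  have hr : 0 ≤ 20 * F / Real.sqrt ν * N * Real.sqrt (γ * L) := by positivity
  rw [← pow_left_inj₀ hl hr two_ne_zero]
  have e1 : Real.sqrt (F / (m * α)) ^ 2 = F / (m * α) := Real.sq_sqrt (by positivity)
  have e2 : Real.sqrt (F / (m * β)) ^ 2 = F / (m * β) := Real.sq_sqrt (by positivity)
  have e3 : Real.sqrt (100 * L / ν) ^ 2 = 100 * L / ν := Real.sq_sqrt (by positivity)
  have e4 : Real.sqrt ν ^ 2 = ν := Real.sq_sqrt hν.le
  have e5 : Real.sqrt (γ * L) ^ 2 = γ * L := Real.sq_sqrt (by positivity)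
  rw [show (2 * m * N ^ 2 * (Real.sqrt (F / (m * α)) * Real.sqrt (F / (m * β)) * Real.sqrt (100 * L / ν))) ^ 2 =
      4 * m ^ 2 * (N ^ 2 * N ^ 2) * (Real.sqrt (F / (m * α)) ^ 2 * Real.sqrt (F / (m * β)) ^ 2 *
        Real.sqrt (100 * L / ν) ^ 2) by ring,
    show (20 * F / Real.sqrt ν * N * Real.sqrt (γ * L)) ^ 2 =
      400 * F ^ 2 * N ^ 2 * Real.sqrt (γ * L) ^ 2 / Real.sqrt ν ^ 2 by ring,
    e1, e2, e3, e4, e5, ← hNsq]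
  field_simp
  ring

set_option maxHeartbeats 1600000 in
/-- **Lopsided near the wall** (unconditional). For `n ≥ 40` and a parity-pure triple `S, T, U ⊆ S_n`
with the triple product property, with `N = |S||T||U|`, `α = |S||T|`, `β = |T||U|`, `γ = |U||S|`,
`D = n(n-1)/6` and `L_x = (1 + log n)·log(4n·n!/x)`:
`2N ≤ n! + n!√(n!)/√D + (20 n!/√n)(√(α L_α) + √(β L_β) + √(γ L_γ))`. [folklore] -/
theorem lopsidedNearWall (n : ℕ) (hn : 40 ≤ n) (S T U : Finset (Equiv.Perm (Fin n))) (hTPP : TripleProductProperty S T U)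
    (hS : ∀ s ∈ S, ∀ s' ∈ S, Equiv.Perm.sign s = Equiv.Perm.sign s')
    (hT : ∀ t ∈ T, ∀ t' ∈ T, Equiv.Perm.sign t = Equiv.Perm.sign t')
    (hU : ∀ u ∈ U, ∀ u' ∈ U, Equiv.Perm.sign u = Equiv.Perm.sign u') :
    2 * ((S.card * T.card * U.card : ℕ) : ℝ) ≤
      (n.factorial : ℝ) + (n.factorial : ℝ) * Real.sqrt (n.factorial : ℝ) / Real.sqrt (((n * (n - 1) : ℕ) : ℝ) / 6) +
        20 * (n.factorial : ℝ) / Real.sqrt n *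
          (Real.sqrt ((S.card * T.card : ℕ) * ((1 + Real.log n) * Real.log (4 * n * n.factorial / (S.card * T.card : ℕ)))) +
            Real.sqrt ((T.card * U.card : ℕ) * ((1 + Real.log n) * Real.log (4 * n * n.factorial / (T.card * U.card : ℕ)))) +
            Real.sqrt ((U.card * S.card : ℕ) * ((1 + Real.log n) * Real.log (4 * n * n.factorial / (U.card * S.card : ℕ))))) := by
  classical
  set N : ℕ := S.card * T.card * U.card with hN
  set P : ℝ := ((S.card * T.card * U.card : ℕ) : ℝ) with hP
  have hF0 : (0 : ℝ) < n.factorial := by exact_mod_cast n.factorial_pos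
  have hn0 : n ≠ 0 := by omega
  have hnR : (0 : ℝ) < n := by exact_mod_cast Nat.pos_of_ne_zero hn0
  have hm : (0 : ℝ) < (n : ℝ) - 1 := by
    have : (40 : ℝ) ≤ n := by exact_mod_cast hn
    linarith
  -- degenerate case
  by_cases hN0 : N = 0
  · have : P = 0 := by rw [hP, ← hN, hN0, Nat.cast_zero]
    rw [this, mul_zero]; positivity
  have hSne : S.Nonempty := Finset.card_ne_zero.1 fun h => hN0 (by simp [hN, h])
  have hTne : T.Nonempty := Finset.card_ne_zero.1 fun h => hN0 (by simp [hN, h])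
  have hUne : U.Nonempty := Finset.card_ne_zero.1 fun h => hN0 (by simp [hN, h])
  have hNpos : (0 : ℝ) < P := by rw [hP, ← hN]; exact_mod_cast Nat.pos_of_ne_zero hN0
  -- quotient sizes
  set α : ℝ := ((S.card * T.card : ℕ) : ℝ) with hα
  set β : ℝ := ((T.card * U.card : ℕ) : ℝ) with hβ
  set γ : ℝ := ((U.card * S.card : ℕ) : ℝ) with hγ
  have hα0 : 0 < α := by rw [hα]; exact_mod_cast Nat.mul_pos hSne.card_pos hTne.card_pos
  have hβ0 : 0 < β := by rw [hβ]; exact_mod_cast Nat.mul_pos hTne.card_pos hUne.card_pos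
  have hγ0 : 0 < γ := by rw [hγ]; exact_mod_cast Nat.mul_pos hUne.card_pos hSne.card_pos
  have hNsq : α * β * γ = P ^ 2 := by rw [hα, hβ, hγ, hP]; push_cast; ring
  -- injectivity of the three quotient maps
  have hinjA := injOn_quot_first hTPP hUne
  have hinjB := injOn_quot_second hTPP hSne
  have hinjC := injOn_quot_first hTPP.rotate.rotate hTne
  -- the logs are non-negative (`α, β, γ ≤ n!`)
  have hlog : ∀ {X Y : Finset (Equiv.Perm (Fin n))}, X.Nonempty → Y.Nonempty →
      Set.InjOn (fun xy : Equiv.Perm (Fin n) × Equiv.Perm (Fin n) => xy.1⁻¹ * xy.2)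
        (↑X ×ˢ ↑Y : Set (Equiv.Perm (Fin n) × Equiv.Perm (Fin n))) →
      0 ≤ Real.log (4 * n * (n.factorial : ℝ) / (X.card * Y.card : ℕ)) := by
    intro X Y hX hY hinj
    apply Real.log_nonneg
    have hc : (0 : ℝ) < (X.card * Y.card : ℕ) := by exact_mod_cast Nat.mul_pos hX.card_pos hY.card_pos
    rw [le_div_iff₀ hc]
    have h1 : ((X.card * Y.card : ℕ) : ℝ) ≤ n.factorial := by
      exact_mod_cast card_mul_card_le_factorial_of_injOn hinj
    nlinarith
  -- (1) the pinning and the six-fold count as a triple sum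
  have hpin := levelOnePinning n hn S T U hTPP hS hT hU
  set mA : Fin n → Fin n → ℝ := fun i j => (((S ×ˢ T).filter fun st => st.2 j = st.1 i).card : ℝ) with hmA
  set mB : Fin n → Fin n → ℝ := fun i j => (((T ×ˢ U).filter fun tu => tu.2 j = tu.1 i).card : ℝ) with hmB
  set mC : Fin n → Fin n → ℝ := fun i j => (((U ×ˢ S).filter fun us => us.2 j = us.1 i).card : ℝ) with hmC
  have hT3 : ((∑ y ∈ ((S ×ˢ T) ×ˢ (T ×ˢ U)) ×ˢ (U ×ˢ S),
      (Finset.univ.filter fun p : Fin n =>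
        (y.1.1.1⁻¹ * y.1.1.2 * (y.1.2.1⁻¹ * y.1.2.2) * (y.2.1⁻¹ * y.2.2)) p = p).card : ℕ) : ℝ) =
      ∑ i : Fin n, ∑ j : Fin n, ∑ k : Fin n, mA i j * mB j k * mC k i := by
    rw [sixFoldFix_eq_tripleSum S T U]
    push_cast
    refine Finset.sum_congr rfl fun i _ => ?_
    rw [Finset.sum_comm]
    refine Finset.sum_congr rfl fun j _ => Finset.sum_congr rfl fun k _ => ?_
    simp only [hmA, hmB, hmC]; ring
  -- (2) normalised arrays and the centring identity
  set a : Fin n → Fin n → ℝ := fun i j => mA i j / α with ha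
  set b : Fin n → Fin n → ℝ := fun i j => mB i j / β with hb
  set c : Fin n → Fin n → ℝ := fun i j => mC i j / γ with hc
  have hsndA : ∀ i, ∑ j : Fin n, mA i j = α := fun i => by
    have h : ∑ j : Fin n, ((((S ×ˢ T).filter fun st => st.2 j = st.1 i).card : ℕ) : ℝ) =
        ((S.card * T.card : ℕ) : ℝ) := by exact_mod_cast sum_pairMarginal_snd S T i
    exact h
  have hsndB : ∀ i, ∑ j : Fin n, mB i j = β := fun i => by
    have h : ∑ j : Fin n, ((((T ×ˢ U).filter fun tu => tu.2 j = tu.1 i).card : ℕ) : ℝ) =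
        ((T.card * U.card : ℕ) : ℝ) := by exact_mod_cast sum_pairMarginal_snd T U i
    exact h
  have hfstB : ∀ j, ∑ i : Fin n, mB i j = β := fun j => by
    have h : ∑ i : Fin n, ((((T ×ˢ U).filter fun tu => tu.2 j = tu.1 i).card : ℕ) : ℝ) =
        ((T.card * U.card : ℕ) : ℝ) := by exact_mod_cast sum_pairMarginal_fst T U j
    exact h
  have hsndC : ∀ i, ∑ j : Fin n, mC i j = γ := fun i => by
    have h : ∑ j : Fin n, ((((U ×ˢ S).filter fun us => us.2 j = us.1 i).card : ℕ) : ℝ) =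
        ((U.card * S.card : ℕ) : ℝ) := by exact_mod_cast sum_pairMarginal_snd U S i
    exact h
  have hfstC : ∀ j, ∑ i : Fin n, mC i j = γ := fun j => by
    have h : ∑ i : Fin n, ((((U ×ˢ S).filter fun us => us.2 j = us.1 i).card : ℕ) : ℝ) =
        ((U.card * S.card : ℕ) : ℝ) := by exact_mod_cast sum_pairMarginal_fst U S j
    exact h
  have har : ∀ i, ∑ j : Fin n, a i j = 1 := fun i => by
    simp only [ha]; rw [← Finset.sum_div, div_eq_one_iff_eq hα0.ne', hsndA]
  have hbr : ∀ j, ∑ k : Fin n, b j k = 1 := fun j => by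
    simp only [hb]; rw [← Finset.sum_div, div_eq_one_iff_eq hβ0.ne', hsndB]
  have hbc : ∀ k, ∑ j : Fin n, b j k = 1 := fun k => by
    simp only [hb]; rw [← Finset.sum_div, div_eq_one_iff_eq hβ0.ne', hfstB]
  have hcr : ∀ k, ∑ i : Fin n, c k i = 1 := fun k => by
    simp only [hc]; rw [← Finset.sum_div, div_eq_one_iff_eq hγ0.ne', hsndC]
  have hcc : ∀ i, ∑ k : Fin n, c k i = 1 := fun i => by
    simp only [hc]; rw [← Finset.sum_div, div_eq_one_iff_eq hγ0.ne', hfstC]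
  have hcen := centered_tripleSum_eq hn0 a b c har hbr hbc hcr hcc
  have habc : ∑ i : Fin n, ∑ j : Fin n, ∑ k : Fin n, a i j * b j k * c k i =
      (∑ i : Fin n, ∑ j : Fin n, ∑ k : Fin n, mA i j * mB j k * mC k i) / (α * β * γ) := by
    rw [Finset.sum_div]
    refine Finset.sum_congr rfl fun i _ => ?_
    rw [Finset.sum_div]
    refine Finset.sum_congr rfl fun j _ => ?_
    rw [Finset.sum_div]
    refine Finset.sum_congr rfl fun k _ => ?_
    simp only [ha, hb, hc]
    field_simp
  -- (3) the positivity inequality for the centred arrays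
  have hneg := neg_tripleSum_le (fun i j => a i j - 1 / n) (fun j k => b j k - 1 / n)
    (fun k i => c k i - 1 / n)
  -- norm and deficit bounds
  have hPA := Real.sqrt_le_sqrt (sumSq_centered_pair_le hn hSne hTne hinjA)
  have hPB := Real.sqrt_le_sqrt (sumSq_centered_pair_le hn hTne hUne hinjB)
  have hPC := Real.sqrt_le_sqrt (sumSq_centered_pair_le hn hUne hSne hinjC)
  have hDA := Real.sqrt_le_sqrt (sumSq_deficit_pair_le hn hSne hTne hinjA)
  have hDB := Real.sqrt_le_sqrt (sumSq_deficit_pair_le hn hTne hUne hinjB)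
  have hDC := Real.sqrt_le_sqrt (sumSq_deficit_pair_le hn hUne hSne hinjC)
  rw [← hα] at hPA hDA
  rw [← hβ] at hPB hDB
  rw [← hγ] at hPC hDC
  change Real.sqrt (∑ i : Fin n, ∑ j : Fin n, (a i j - 1 / n) ^ 2) ≤ _ at hPA
  change Real.sqrt (∑ i : Fin n, ∑ j : Fin n, (b i j - 1 / n) ^ 2) ≤ _ at hPB
  change Real.sqrt (∑ i : Fin n, ∑ j : Fin n, (c i j - 1 / n) ^ 2) ≤ _ at hPC
  change Real.sqrt (∑ i : Fin n, ∑ j : Fin n, (max 0 (-(a i j - 1 / n))) ^ 2) ≤ _ at hDA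
  change Real.sqrt (∑ i : Fin n, ∑ j : Fin n, (max 0 (-(b i j - 1 / n))) ^ 2) ≤ _ at hDB
  change Real.sqrt (∑ i : Fin n, ∑ j : Fin n, (max 0 (-(c i j - 1 / n))) ^ 2) ≤ _ at hDC
  have hG0 : 0 ≤ 1 + Real.log n := by
    have := Real.log_nonneg (show (1 : ℝ) ≤ n by exact_mod_cast Nat.pos_of_ne_zero hn0); linarith
  set LA : ℝ := (1 + Real.log n) * Real.log (4 * n * (n.factorial : ℝ) / α) with hLA
  set LB : ℝ := (1 + Real.log n) * Real.log (4 * n * (n.factorial : ℝ) / β) with hLB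
  set LC : ℝ := (1 + Real.log n) * Real.log (4 * n * (n.factorial : ℝ) / γ) with hLC
  have hLA0 : 0 ≤ LA := by rw [hLA, hα]; exact mul_nonneg hG0 (hlog hSne hTne hinjA)
  have hLB0 : 0 ≤ LB := by rw [hLB, hβ]; exact mul_nonneg hG0 (hlog hTne hUne hinjB)
  have hLC0 : 0 ≤ LC := by rw [hLC, hγ]; exact mul_nonneg hG0 (hlog hUne hSne hinjC)
  -- the three cyclic terms
  have hX1 : Real.sqrt (∑ i : Fin n, ∑ j : Fin n, (a i j - 1 / n) ^ 2) *
      Real.sqrt (∑ j : Fin n, ∑ k : Fin n, (b j k - 1 / n) ^ 2) *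
        Real.sqrt (∑ k : Fin n, ∑ i : Fin n, (max 0 (-(c k i - 1 / n))) ^ 2) ≤
      Real.sqrt ((n.factorial : ℝ) / (((n : ℝ) - 1) * α)) * Real.sqrt ((n.factorial : ℝ) / (((n : ℝ) - 1) * β)) * Real.sqrt (100 * LC / n) :=
    mul_le_mul (mul_le_mul hPA hPB (Real.sqrt_nonneg _) (Real.sqrt_nonneg _)) hDC (Real.sqrt_nonneg _)
      (by positivity)
  have hX2 : Real.sqrt (∑ i : Fin n, ∑ j : Fin n, (a i j - 1 / n) ^ 2) *
      Real.sqrt (∑ j : Fin n, ∑ k : Fin n, (max 0 (-(b j k - 1 / n))) ^ 2) *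
        Real.sqrt (∑ k : Fin n, ∑ i : Fin n, (c k i - 1 / n) ^ 2) ≤
      Real.sqrt ((n.factorial : ℝ) / (((n : ℝ) - 1) * α)) * Real.sqrt (100 * LB / n) * Real.sqrt ((n.factorial : ℝ) / (((n : ℝ) - 1) * γ)) :=
    mul_le_mul (mul_le_mul hPA hDB (Real.sqrt_nonneg _) (Real.sqrt_nonneg _)) hPC (Real.sqrt_nonneg _)
      (by positivity)
  have hX3 : Real.sqrt (∑ i : Fin n, ∑ j : Fin n, (max 0 (-(a i j - 1 / n))) ^ 2) *
      Real.sqrt (∑ j : Fin n, ∑ k : Fin n, (b j k - 1 / n) ^ 2) *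
        Real.sqrt (∑ k : Fin n, ∑ i : Fin n, (c k i - 1 / n) ^ 2) ≤
      Real.sqrt (100 * LA / n) * Real.sqrt ((n.factorial : ℝ) / (((n : ℝ) - 1) * β)) * Real.sqrt ((n.factorial : ℝ) / (((n : ℝ) - 1) * γ)) :=
    mul_le_mul (mul_le_mul hDA hPB (Real.sqrt_nonneg _) (Real.sqrt_nonneg _)) hPC (Real.sqrt_nonneg _)
      (by positivity)
  -- the cyclic terms simplified
  have hY1 := cyclicTerm_eq (F := (n.factorial : ℝ)) (L := LC) hα0 hβ0 hγ0 hNpos hNsq hm hnR hF0.le hLC0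
  have hY2 : 2 * ((n : ℝ) - 1) * P ^ 2 * (Real.sqrt ((n.factorial : ℝ) / (((n : ℝ) - 1) * α)) *
      Real.sqrt (100 * LB / n) * Real.sqrt ((n.factorial : ℝ) / (((n : ℝ) - 1) * γ))) =
      20 * (n.factorial : ℝ) / Real.sqrt n * P * Real.sqrt (β * LB) := by
    have h := cyclicTerm_eq (F := (n.factorial : ℝ)) (L := LB) hγ0 hα0 hβ0 hNpos (by rw [← hNsq]; ring) hm hnR hF0.le hLB0
    rw [← h]; ring
  have hY3 : 2 * ((n : ℝ) - 1) * P ^ 2 * (Real.sqrt (100 * LA / n) *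
      Real.sqrt ((n.factorial : ℝ) / (((n : ℝ) - 1) * β)) * Real.sqrt ((n.factorial : ℝ) / (((n : ℝ) - 1) * γ))) =
      20 * (n.factorial : ℝ) / Real.sqrt n * P * Real.sqrt (α * LA) := by
    have h := cyclicTerm_eq (F := (n.factorial : ℝ)) (L := LA) hβ0 hγ0 hα0 hNpos (by rw [← hNsq]; ring) hm hnR hF0.le hLA0
    rw [← h]; ring
  -- (4) assemble: `2N² - FN - N (n.factorial : ℝ)√(n.factorial : ℝ)/√D ≤ 2(n-1)(N² - T₃) = 2(n-1)N²·(-Σ PQR) ≤ …`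
  have hmain : 2 * ((n : ℝ) - 1) * (P ^ 2 -
      ∑ i : Fin n, ∑ j : Fin n, ∑ k : Fin n, mA i j * mB j k * mC k i) =
      2 * ((n : ℝ) - 1) * P ^ 2 *
        (-(∑ i : Fin n, ∑ j : Fin n, ∑ k : Fin n, (a i j - 1 / n) * (b j k - 1 / n) * (c k i - 1 / n))) := by
    have hP2 : P ^ 2 ≠ 0 := pow_ne_zero 2 hNpos.ne'
    rw [hcen, habc, hNsq]
    field_simp
    ring
  rw [hT3, Nat.cast_pow, ← hP] at hpin
  have h2 : 2 * ((n : ℝ) - 1) * P ^ 2 *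
      (-(∑ i : Fin n, ∑ j : Fin n, ∑ k : Fin n, (a i j - 1 / n) * (b j k - 1 / n) * (c k i - 1 / n))) ≤
      20 * (n.factorial : ℝ) / Real.sqrt n * P * (Real.sqrt (α * LA) + Real.sqrt (β * LB) + Real.sqrt (γ * LC)) := by
    have hcoef : 0 ≤ 2 * ((n : ℝ) - 1) * P ^ 2 := by positivity
    calc 2 * ((n : ℝ) - 1) * P ^ 2 *
          (-(∑ i : Fin n, ∑ j : Fin n, ∑ k : Fin n, (a i j - 1 / n) * (b j k - 1 / n) * (c k i - 1 / n)))
        ≤ 2 * ((n : ℝ) - 1) * P ^ 2 *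
            (Real.sqrt ((n.factorial : ℝ) / (((n : ℝ) - 1) * α)) * Real.sqrt ((n.factorial : ℝ) / (((n : ℝ) - 1) * β)) *
                Real.sqrt (100 * LC / n) +
              Real.sqrt ((n.factorial : ℝ) / (((n : ℝ) - 1) * α)) * Real.sqrt (100 * LB / n) *
                Real.sqrt ((n.factorial : ℝ) / (((n : ℝ) - 1) * γ)) +
              Real.sqrt (100 * LA / n) * Real.sqrt ((n.factorial : ℝ) / (((n : ℝ) - 1) * β)) *
                Real.sqrt ((n.factorial : ℝ) / (((n : ℝ) - 1) * γ))) := by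
          refine mul_le_mul_of_nonneg_left (hneg.trans ?_) hcoef
          linarith [hX1, hX2, hX3]
      _ = 20 * (n.factorial : ℝ) / Real.sqrt n * P * (Real.sqrt (α * LA) + Real.sqrt (β * LB) + Real.sqrt (γ * LC)) := by
          rw [mul_add, mul_add, hY1, hY2, hY3]; ring
  -- divide by `N > 0`
  have hfin : 2 * P ^ 2 - (n.factorial : ℝ) * P - P * ((n.factorial : ℝ) * Real.sqrt (n.factorial : ℝ)) / Real.sqrt (((n * (n - 1) : ℕ) : ℝ) / 6) ≤
      P * (20 * (n.factorial : ℝ) / Real.sqrt n * (Real.sqrt (α * LA) + Real.sqrt (β * LB) + Real.sqrt (γ * LC))) := by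
    have := hpin.trans (le_of_eq hmain)
    linarith
  have hdiv : 2 * P - (n.factorial : ℝ) - ((n.factorial : ℝ) * Real.sqrt (n.factorial : ℝ)) / Real.sqrt (((n * (n - 1) : ℕ) : ℝ) / 6) ≤
      20 * (n.factorial : ℝ) / Real.sqrt n * (Real.sqrt (α * LA) + Real.sqrt (β * LB) + Real.sqrt (γ * LC)) := by
    have e : P * (2 * P - (n.factorial : ℝ) - ((n.factorial : ℝ) * Real.sqrt (n.factorial : ℝ)) / Real.sqrt (((n * (n - 1) : ℕ) : ℝ) / 6)) =
        2 * P ^ 2 - (n.factorial : ℝ) * P - P * ((n.factorial : ℝ) * Real.sqrt (n.factorial : ℝ)) / Real.sqrt (((n * (n - 1) : ℕ) : ℝ) / 6) := by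
      ring
    have h' : P * (2 * P - (n.factorial : ℝ) - ((n.factorial : ℝ) * Real.sqrt (n.factorial : ℝ)) / Real.sqrt (((n * (n - 1) : ℕ) : ℝ) / 6)) ≤
        P * (20 * (n.factorial : ℝ) / Real.sqrt n * (Real.sqrt (α * LA) + Real.sqrt (β * LB) + Real.sqrt (γ * LC))) := by
      rw [e]; exact hfin
    exact le_of_mul_le_mul_left h' hNpos
  linarith [hdiv]

end Summit.MatrixMultiplication.MatrixMultiplication.Theorems.PolynomialSlack
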